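import Literature.Topology.FourManifolds.DehnSurgery
import Literature.Topology.FourManifolds.MappingTorus
import Literature.Topology.FourManifolds.CircleSurgery
import HarnessLib

/-!
# Fibred knots with capped monodromy (relational form)

A knot `K ⊂ S³` is *fibred* if its complement fibres over the circle, `π : S³ ∖ K → S¹`, the
closure of every fibre being a Seifert surface of `K` (Juhász, *Differential and Low-Dimensional
Topology* (2023), Def. 4.64; Etnyre, *Lectures on open book decompositions and contact structures*
(2006), Def. 2.1: `(K, π)` is an *open book decomposition* of `S³` with connected binding `K`). In
the smooth category the fibration is taken to be the *standard open book near the binding*: on a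
tubular neighbourhood `S¹ × D²` of `K` the map `π` is the angular coordinate of the normal disc
(Etnyre 2006, §2, and the binding coordinates `(ψ, (r, θ))` with `π^* dθ = dθ` in the proof of his
Lemma 3.3). The fibre is then the interior `Σ°` of a compact surface `Σ` with `∂Σ = K`, the
first-return map of a flow transverse to the pages and meridional near `K` is the *monodromy*
`h : Σ → Σ`, a diffeomorphism which is the identity near `∂Σ` (an *abstract open book* `(Σ, h)`,
Etnyre 2006, Def. 2.2; Abe–Tagami, *Fibered knots with the same `0`-surgery and the slice-ribbon
conjecture* (2016), App. B §5.1), and `S³ ∖ K` is the mapping torus of `h|Σ°`. Capping `∂Σ` with a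
disc gives the closed surface `F = Σ ∪ D²` and the *capped (closed) monodromy* `φ = h ∪ id : F → F`;
`0`-surgery on `K` is the `F`-bundle over `S¹` with monodromy `φ` (Abe–Tagami 2016, §5.5).

This file renders "`K` is fibred with capped fibre `F`, puncture `p ∈ F` (the centre of the
capping disc) and capped monodromy `φ : F ≃ₘ F`" over the tree's vocabulary — smooth mapping tori
as open gluings (`Literature.Topology.FourManifolds.IsOpenGluingWith`,
`Literature.Topology.FourManifolds.mappingTorusRel`, `Literature.Topology.FourManifolds.IsMappingTorusOf`),
oriented tubular neighbourhoods `Literature.Topology.FourManifolds.Knot.TubularNbhd` and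
`Literature.Topology.FourManifolds.circlePoint` — without building any quotient:

* `Literature.Topology.FourManifolds.punctureAt p`: the open submanifold `F ∖ {p}`;
  `Diffeomorph.restrPuncture φ p hp` (dot-notation extension): the restriction of a
  diffeomorphism `φ` with `φ p = p` to `F ∖ {p}`.
* `Literature.Topology.FourManifolds.Knot.FibresWithVia K ν F p φ` (**the definition requested by
  item `defn-Knot.FibresWithVia`**; body = the checked rendering of the crux line
  `monodromy-kernel-engine` of `Summits/SmoothPoincare4` up to `puncture F p ↦ punctureAt p`,
  `T2Space ↦ T1Space`, `F : Type ↦ Type*`): there are a self-diffeomorphism `θ` of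
  `F ∖ {p}` agreeing with `φ`, open smooth embeddings `jA : (F ∖ {p}) × (0,1) → S³ ∖ K`,
  `jB : (F ∖ {p}) × (1/2,3/2) → S³ ∖ K` presenting the knot complement as a smooth mapping torus
  of `θ` (`IsOpenGluingWith … (mappingTorusRel θ) jA jB`; the pages are the slices
  `(F ∖ {p}) × {s}`), and a disc chart `d : ℝ² → F` centred at `p` on whose punctured unit disc
  both gluing maps are the STANDARD OPEN BOOK of the binding neighbourhood `ν`:
  the page point `d (r • u)` (`0 < r < 1`, `u ∈ S¹`) at page angle `s` is `ν (u, r • e^{2πis})`.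
* `Literature.Topology.FourManifolds.Knot.FibresWith K F p φ`: the same through SOME `ν`;
  `Literature.Topology.FourManifolds.Knot.IsFibred K`: `K` is a fibred knot (some closed connected
  smooth surface `F`, `p`, `φ`).

## API (all proved)

* `Knot.FibresWithVia.apply_puncture`: `φ p = p`; `Knot.fibresWithVia_iff_restrPuncture`: the
  datum `θ` is `φ.restrPuncture p _` (the definition read without the auxiliary `θ`);
  `Knot.FibresWithVia.isMappingTorusOf`: `S³ ∖ K` is a smooth mapping torus (`IsMappingTorusOf`)
  of `φ` restricted to `F ∖ {p}`; `Knot.FibresWithVia.theta_apply_eq`, `….exists_disc_fixed`: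
  the capped monodromy is the IDENTITY on the capping disc (`φ (d w) = d w`, `‖w‖ < 1`) — the
  clause "`h = id` near `∂Σ`, capped by the identity" of the abstract open book is a consequence
  of the standard-open-book clauses, not an extra axiom.

## Design notes

* Hypotheses on `F` are minimal (`T1Space`, `ChartedSpace ℝ²`), as for `IsMappingTorusOf`;
  consumers add `[T2Space F] [SecondCountableTopology F] [IsManifold (𝓡 2) ∞ F] [CompactSpace F]
  [ConnectedSpace F]` ("closed connected smooth surface"), and `Knot.IsFibred` quantifies over
  exactly these. Orientability of `F` and orientation preservation of `φ` are forced (an open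
  subset of `(F ∖ {p}) × ℝ` embeds openly in `S³`), so they are not fields.
* Direction conventions are the tree's: `jA (x, s) = jB (θ x, s + 1)` (`mappingTorusRel`,
  `MappingTorus.mk_apply_add_one`), and turning the pages positively (`s ↦ s + ε`) is positive
  rotation `e^{2πis}` of the normal disc of the ORIENTED tubular neighbourhood `ν`
  (`Knot.TubularNbhd.det_pos`), i.e. the pages wind positively around the oriented meridian of `ν`.
* What is NOT here (named facts wanted with the definition, to be vendored separately): the page
  framing is the Seifert framing (`K.FibresWithVia ν F p φ → ν.HasFraming 0`); `0`-surgery on a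
  fibred knot is the mapping torus of the capped monodromy (Abe–Tagami 2016, §5.5); Gabai's
  theorem that fibredness is a `0`-surgery invariant (Gabai, J. Differential Geom. 26 (1987),
  Cor. 8.19) and Stallings' fibration theorem (Juhász 2023, Thm 4.67).

## References

* A. Juhász, *Differential and Low-Dimensional Topology*, CUP (2023), §4.7, Def. 4.64 (p. 139).
* J. Etnyre, *Lectures on open book decompositions and contact structures*, Clay Math. Proc. 5
  (2006), §2 (Def. 2.1, Def. 2.2, Lemma 2.3); numbering of arXiv:math/0409402.
* T. Abe, K. Tagami, *Fibered knots with the same `0`-surgery and the slice-ribbon conjecture*,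
  Math. Res. Lett. 23 (2016), App. B (§5.1 open books, monodromy; §5.5 closed monodromy); arXiv numbering.
-/

open scoped Manifold ContDiff Topology
open Function Set

noncomputable section

namespace Literature.Topology.FourManifolds

/-- Local notation: `𝔼 n` is the model Euclidean space `EuclideanSpace ℝ (Fin n)`. -/
local notation "𝔼 " n:arg => EuclideanSpace ℝ (Fin n)

/-- Local notation: `𝕊 n` is the unit sphere in `EuclideanSpace ℝ (Fin (n + 1))`. -/
local notation "𝕊 " n:arg => (Metric.sphere (0 : EuclideanSpace ℝ (Fin (n + 1))) 1)

/-! ### Punctured manifolds -/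

section Puncture

variable {F : Type*} [TopologicalSpace F] [T1Space F]

/-- The **space punctured at a point**, `F ∖ {p}`, as an open subset of `F` (so that, for a charted
space `F`, it carries Mathlib's open-submanifold structure `TopologicalSpace.Opens.instChartedSpace`);
the interior `Σ° ≅ F ∖ {p}` of the page of an open book with capped page `F` (Etnyre 2006,
Def. 2.1–2.2). The tree's `puncture i` (`ConnectedSum.lean`, puncture along a disc `i : X → F` at
`i 0`) is `punctureAt (i 0)` definitionally (`puncture_eq_punctureAt`). [folklore] -/
def punctureAt (p : F) : TopologicalSpace.Opens F :=
  ⟨{p}ᶜ, isOpen_compl_singleton⟩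

/-- The carrier of `punctureAt p` is `{p}ᶜ`. [folklore] -/
@[simp] theorem coe_punctureAt (p : F) : (punctureAt p : Set F) = {p}ᶜ := rfl

/-- Membership in the puncture: `x ∈ F ∖ {p} ↔ x ≠ p`. [folklore] -/
@[simp] theorem mem_punctureAt_iff {p x : F} : x ∈ punctureAt p ↔ x ≠ p := Iff.rfl

/-- A point of the puncture is not the puncture point. [folklore] -/
theorem coe_ne_of_mem_punctureAt {p : F} (y : ↥(punctureAt p)) : (y : F) ≠ p :=
  mem_punctureAt_iff.mp y.2

/-- Bridge to the connected-sum vocabulary: puncturing along a disc `i : X → F` (`puncture i`,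
`ConnectedSum.lean`) is puncturing at its centre `i 0`, definitionally. [folklore] -/
theorem puncture_eq_punctureAt {X : Type*} [Zero X] (i : X → F) : puncture i = punctureAt (i 0) :=
  rfl

end Puncture

/-! ### Restricting a diffeomorphism fixing the puncture point -/

section Restrict

variable {E H : Type*} [NormedAddCommGroup E] [NormedSpace ℝ E] [TopologicalSpace H]
  {I : ModelWithCorners ℝ E H}
  {F : Type*} [TopologicalSpace F] [T1Space F] [ChartedSpace H F]

/-- **Restriction of a diffeomorphism to the puncture.** A diffeomorphism `φ` of `F` with
`φ p = p` restricts to a diffeomorphism of the open submanifold `F ∖ {p}` (smoothness of maps into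
and out of open subsets: Mathlib's `ContMDiff.subtypeVal_comp_iff`, `contMDiff_subtype_val`). For
the capped monodromy `φ = h ∪ id` of a fibred knot this recovers the monodromy `h|Σ°` of the open
page (Etnyre 2006, Def. 2.2 and Lemma 2.3). Deliberate dot-notation extension in Mathlib's
`Diffeomorph` namespace (`φ.restrPuncture p hp`), as the tree's `Diffeomorph.restrOpens`
(`KirbyMovesHandleSlide.lean`, of which this is the case `U = V = punctureAt p`, restated here to
keep the imports of this file minimal). [folklore] -/
def _root_.Diffeomorph.restrPuncture (φ : F ≃ₘ⟮I, I⟯ F) (p : F) (hp : φ p = p) :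
    ↥(punctureAt p) ≃ₘ⟮I, I⟯ ↥(punctureAt p) where
  toFun y := ⟨φ y, mem_punctureAt_iff.mpr fun h =>
    coe_ne_of_mem_punctureAt y (φ.injective (h.trans hp.symm))⟩
  invFun y := ⟨φ.symm y, mem_punctureAt_iff.mpr fun h =>
    coe_ne_of_mem_punctureAt y (by rw [← φ.apply_symm_apply y, h, hp])⟩
  left_inv y := Subtype.ext (φ.symm_apply_apply y)
  right_inv y := Subtype.ext (φ.apply_symm_apply y)
  contMDiff_toFun :=
    (ContMDiff.subtypeVal_comp_iff (punctureAt p) _).mp (φ.contMDiff.comp contMDiff_subtype_val)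
  contMDiff_invFun :=
    (ContMDiff.subtypeVal_comp_iff (punctureAt p) _).mp
      (φ.symm.contMDiff.comp contMDiff_subtype_val)

/-- Values of the restriction: `φ.restrPuncture p hp y = φ y` in `F` (dot-notation extension in
Mathlib's `Diffeomorph` namespace, with `Diffeomorph.restrPuncture`). [folklore] -/
@[simp] theorem _root_.Diffeomorph.coe_restrPuncture_apply (φ : F ≃ₘ⟮I, I⟯ F) (p : F)
    (hp : φ p = p) (y : ↥(punctureAt p)) :
    ((φ.restrPuncture p hp y : ↥(punctureAt p)) : F) = φ y :=
  rfl

/-- Values of the inverse of the restriction: `(φ.restrPuncture p hp)⁻¹ y = φ⁻¹ y` in `F`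
(dot-notation extension in Mathlib's `Diffeomorph` namespace, with `Diffeomorph.restrPuncture`).
[folklore] -/
@[simp] theorem _root_.Diffeomorph.coe_restrPuncture_symm_apply (φ : F ≃ₘ⟮I, I⟯ F) (p : F)
    (hp : φ p = p) (y : ↥(punctureAt p)) :
    (((φ.restrPuncture p hp).symm y : ↥(punctureAt p)) : F) = φ.symm y :=
  rfl

/-- **Uniqueness of the restriction.** A self-diffeomorphism `θ` of `F ∖ {p}` that agrees with
`φ` is `φ.restrPuncture p hp`. [folklore] -/
theorem eq_restrPuncture_of_forall_coe_eq {φ : F ≃ₘ⟮I, I⟯ F} {p : F} (hp : φ p = p)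
    {θ : ↥(punctureAt p) ≃ₘ⟮I, I⟯ ↥(punctureAt p)}
    (hθ : ∀ y : ↥(punctureAt p), ((θ y : ↥(punctureAt p)) : F) = φ (y : F)) :
    θ = φ.restrPuncture p hp :=
  Diffeomorph.ext fun y => Subtype.ext (hθ y)

/-- A self-diffeomorphism `θ` of `F ∖ {p}` that agrees with a diffeomorphism `φ` of `F` forces
`φ p = p`: `θ` is onto `F ∖ {p}` and `φ` is injective. [folklore] -/
theorem apply_eq_self_of_forall_coe_eq {φ : F ≃ₘ⟮I, I⟯ F} {p : F}
    {θ : ↥(punctureAt p) ≃ₘ⟮I, I⟯ ↥(punctureAt p)}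
    (hθ : ∀ y : ↥(punctureAt p), ((θ y : ↥(punctureAt p)) : F) = φ (y : F)) : φ p = p := by
  by_contra hne
  obtain ⟨y, hy⟩ := (EquivLike.surjective θ) ⟨φ p, mem_punctureAt_iff.mpr hne⟩
  have h1 : φ (y : F) = φ p := by rw [← hθ y, hy]
  exact coe_ne_of_mem_punctureAt y (φ.injective h1)

end Restrict

/-! ### Fibred knots with capped monodromy -/

section FibredKnot

/-- **`K` fibres over the circle through the binding neighbourhood `ν`, with capped fibre `F`,
puncture `p` and capped monodromy `φ`.** There are: a self-diffeomorphism `θ` of the punctured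
surface `F ∖ {p}` which is the restriction of `φ` (so `φ p = p`, `Knot.FibresWithVia.apply_puncture`,
and `θ = φ.restrPuncture p _`, `Knot.fibresWithVia_iff_restrPuncture`); open smooth embeddings
`jA : (F ∖ {p}) × (0,1) → S³ ∖ K`, `jB : (F ∖ {p}) × (1/2,3/2) → S³ ∖ K` exhibiting the knot
complement as a SMOOTH MAPPING TORUS of `θ` (`IsOpenGluingWith … (mappingTorusRel θ) jA jB`: they
cover `S³ ∖ K` and `jA (x, s) = jB (y, t) ↔ (t = s ∧ y = x) ∨ (t = s + 1 ∧ y = θ x)`; the pages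
are the slices `(F ∖ {p}) × {s}`, the first-return class is `θ` in the tree's direction
convention); and a disc chart `d : ℝ² → F` at `p` (`C^∞` embedding, open range, `d 0 = p`) on
whose punctured unit disc the fibration is the STANDARD OPEN BOOK near the binding: the page
point `d (r • u)` (`0 < r < 1`, `u ∈ 𝕊 1`) at page angle `s` (resp. `t`) is
`ν (u, r • e^{2πis})` under `jA` (resp. `ν (u, r • e^{2πit})` under `jB`) — radius in the page
is radius in the tube, the angle around the puncture is the knot parameter, and turning the
pages is positive meridional rotation in the oriented tubular neighbourhood `ν`. Consequences,
not clauses: `θ = id` on the punctured disc and `φ = id` on the disc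
(`Knot.FibresWithVia.exists_disc_fixed`), i.e. `φ` IS the capped monodromy `h ∪ id` of the
abstract open book `(F ∖ d(D̊²), h = φ|)` whose binding is `K`; the longitude of `ν` lies on a
page. This is "`(K, π)` is an open book decomposition of `S³` with page `F ∖ D̊²` and monodromy
`φ|`" (Etnyre 2006, Def. 2.1–2.2, Lemma 2.3; Juhász 2023, Def. 4.64; Abe–Tagami 2016, App. B
§5.1) in the standard binding coordinates, over the tree's `IsOpenGluingWith`, `mappingTorusRel`,
`Knot.TubularNbhd`, `circlePoint`. Hypotheses on `F` are minimal; consumers add "closed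
connected smooth surface" (see `Knot.IsFibred`). [cite: Etnyre2006, §2 Def. 2.1–2.2 and Lemma 2.3] -/
def Knot.FibresWithVia (K : Knot) (ν : Knot.TubularNbhd K) (F : Type*) [TopologicalSpace F]
    [T1Space F] [ChartedSpace (𝔼 2) F] (p : F) (φ : F ≃ₘ⟮𝓡 2, 𝓡 2⟯ F) : Prop :=
  ∃ (θ : ↥(punctureAt p) ≃ₘ⟮𝓡 2, 𝓡 2⟯ ↥(punctureAt p))
    (jA : ↥(punctureAt p) × ↥mappingTorusPieceOne → ↥K.complement)
    (jB : ↥(punctureAt p) × ↥mappingTorusPieceTwo → ↥K.complement)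
    (d : (𝔼 2) → F),
    (∀ y : ↥(punctureAt p), ((θ y : ↥(punctureAt p)) : F) = φ (y : F)) ∧
    IsOpenGluingWith ((𝓡 2).prod 𝓘(ℝ, ℝ)) ((𝓡 2).prod 𝓘(ℝ, ℝ)) (𝓡 3)
      (mappingTorusRel ⇑θ) jA jB ∧
    Manifold.IsSmoothEmbedding (𝓡 2) (𝓡 2) ∞ d ∧ IsOpen (range d) ∧ d 0 = p ∧
    (∀ (y : ↥(punctureAt p)) (u : 𝕊 1) (r : ℝ), r ∈ Ioo (0 : ℝ) 1 →
      (y : F) = d (r • ((u : 𝕊 1) : 𝔼 2)) →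
        (∀ s : ↥mappingTorusPieceOne,
          ((jA (y, s) : ↥K.complement) : 𝕊 3) =
            ν (u, r • ((circlePoint (2 * Real.pi * (s : ℝ)) : 𝕊 1) : 𝔼 2))) ∧
        (∀ t : ↥mappingTorusPieceTwo,
          ((jB (y, t) : ↥K.complement) : 𝕊 3) =
            ν (u, r • ((circlePoint (2 * Real.pi * (t : ℝ)) : 𝕊 1) : 𝔼 2))))

/-- **`K` is fibred with capped fibre `F`, puncture `p` and capped monodromy `φ`**, through SOME
oriented tubular (binding) neighbourhood `ν` of `K` (Etnyre 2006, Def. 2.1–2.2; Juhász 2023,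
Def. 4.64). [cite: Etnyre2006, §2 Def. 2.1–2.2] -/
def Knot.FibresWith (K : Knot) (F : Type*) [TopologicalSpace F] [T1Space F]
    [ChartedSpace (𝔼 2) F] (p : F) (φ : F ≃ₘ⟮𝓡 2, 𝓡 2⟯ F) : Prop :=
  ∃ ν : Knot.TubularNbhd K, K.FibresWithVia ν F p φ

/-- **Fibred knot.** The knot `K ⊂ S³` is *fibred*: for some closed connected smooth surface `F`
(Hausdorff, second countable, `C^∞` for `𝓡 2`, compact, connected), some point `p ∈ F` and some
diffeomorphism `φ` of `F`, `K` fibres with capped fibre `F`, puncture `p` and capped monodromy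
`φ` (`Knot.FibresWith`): the complement `S³ ∖ K` is a smooth fibre bundle over the circle whose
fibres are interiors of Seifert surfaces of `K`, standard near `K` (Juhász 2023, Def. 4.64;
Etnyre 2006, Def. 2.1 with connected binding). `F` is quantified in `Type`. [cite: Juhasz2023, Def. 4.64] -/
def Knot.IsFibred (K : Knot) : Prop :=
  ∃ (F : Type) (_ : TopologicalSpace F) (_ : T2Space F) (_ : SecondCountableTopology F)
    (_ : ChartedSpace (𝔼 2) F) (_ : IsManifold (𝓡 2) ∞ F) (_ : CompactSpace F)
    (_ : ConnectedSpace F) (p : F) (φ : F ≃ₘ⟮𝓡 2, 𝓡 2⟯ F), K.FibresWith F p φ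

variable {K : Knot} {ν : Knot.TubularNbhd K} {F : Type*} [TopologicalSpace F] [T1Space F]
  [ChartedSpace (𝔼 2) F] {p : F} {φ : F ≃ₘ⟮𝓡 2, 𝓡 2⟯ F}

/-- Forgetting the binding neighbourhood. [folklore] -/
theorem Knot.FibresWithVia.fibresWith (h : K.FibresWithVia ν F p φ) : K.FibresWith F p φ :=
  ⟨ν, h⟩

/-- A knot fibred with a closed connected smooth capped fibre is a fibred knot. [folklore] -/
theorem Knot.FibresWith.isFibred {K : Knot} {F : Type} [TopologicalSpace F] [T2Space F]
    [SecondCountableTopology F] [ChartedSpace (𝔼 2) F] [IsManifold (𝓡 2) ∞ F] [CompactSpace F]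
    [ConnectedSpace F] {p : F} {φ : F ≃ₘ⟮𝓡 2, 𝓡 2⟯ F} (h : K.FibresWith F p φ) : K.IsFibred :=
  ⟨F, inferInstance, inferInstance, inferInstance, inferInstance, inferInstance, inferInstance,
    inferInstance, p, φ, h⟩

/-- **The capped monodromy fixes the puncture**: `θ` is a bijection of `F ∖ {p}` agreeing with
the injective `φ`, so `φ p = p`. [folklore] -/
theorem Knot.FibresWithVia.apply_puncture (h : K.FibresWithVia ν F p φ) : φ p = p := by
  obtain ⟨θ, -, -, -, hθ, -⟩ := h
  exact apply_eq_self_of_forall_coe_eq hθ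

/-- **`Knot.FibresWithVia` without the auxiliary `θ`.** The datum `θ` of the definition is
necessarily `φ.restrPuncture p hp` (`eq_restrPuncture_of_forall_coe_eq`), so
`K.FibresWithVia ν F p φ` says: `φ p = p`, and `S³ ∖ K` is a smooth mapping torus of
`φ|(F ∖ {p})` through gluing maps that are the standard open book of `ν` on a punctured disc
chart at `p`. [folklore] -/
theorem Knot.fibresWithVia_iff_restrPuncture :
    K.FibresWithVia ν F p φ ↔ ∃ (hp : φ p = p)
      (jA : ↥(punctureAt p) × ↥mappingTorusPieceOne → ↥K.complement)
      (jB : ↥(punctureAt p) × ↥mappingTorusPieceTwo → ↥K.complement)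
      (d : (𝔼 2) → F),
      IsOpenGluingWith ((𝓡 2).prod 𝓘(ℝ, ℝ)) ((𝓡 2).prod 𝓘(ℝ, ℝ)) (𝓡 3)
        (mappingTorusRel ⇑(φ.restrPuncture p hp)) jA jB ∧
      Manifold.IsSmoothEmbedding (𝓡 2) (𝓡 2) ∞ d ∧ IsOpen (range d) ∧ d 0 = p ∧
      (∀ (y : ↥(punctureAt p)) (u : 𝕊 1) (r : ℝ), r ∈ Ioo (0 : ℝ) 1 →
        (y : F) = d (r • ((u : 𝕊 1) : 𝔼 2)) →
          (∀ s : ↥mappingTorusPieceOne,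
            ((jA (y, s) : ↥K.complement) : 𝕊 3) =
              ν (u, r • ((circlePoint (2 * Real.pi * (s : ℝ)) : 𝕊 1) : 𝔼 2))) ∧
          (∀ t : ↥mappingTorusPieceTwo,
            ((jB (y, t) : ↥K.complement) : 𝕊 3) =
              ν (u, r • ((circlePoint (2 * Real.pi * (t : ℝ)) : 𝕊 1) : 𝔼 2)))) := by
  constructor
  · rintro ⟨θ, jA, jB, d, hθ, hrest⟩
    have hp : φ p = p := apply_eq_self_of_forall_coe_eq hθ
    refine ⟨hp, jA, jB, d, ?_⟩
    rw [← eq_restrPuncture_of_forall_coe_eq hp hθ]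
    exact hrest
  · rintro ⟨hp, jA, jB, d, hrest⟩
    exact ⟨φ.restrPuncture p hp, jA, jB, d, fun y => rfl, hrest⟩

/-- **The knot complement is a smooth mapping torus of the punctured monodromy**: if `K` fibres
through `ν` with capped monodromy `φ`, then `S³ ∖ K` is a smooth mapping torus, in the sense of
`IsMappingTorusOf (𝓡 3)`, of `φ` restricted to `F ∖ {p}` (Etnyre 2006, Def. 2.2: the complement
of the binding is the mapping torus of the monodromy). [cite: Etnyre2006, §2 Def. 2.2] -/
theorem Knot.FibresWithVia.isMappingTorusOf (h : K.FibresWithVia ν F p φ) :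
    IsMappingTorusOf (𝓡 3) (↥K.complement) (φ.restrPuncture p h.apply_puncture) := by
  obtain ⟨hp, jA, jB, d, hglue, -⟩ := Knot.fibresWithVia_iff_restrPuncture.mp h
  exact hglue.isOpenGluing

/-- `1/4 ∈ (0, 1)`: a page angle in the first cylinder. [folklore] -/
private theorem quarter_mem_mappingTorusPieceOne : (1 / 4 : ℝ) ∈ mappingTorusPieceOne := by
  change (1 / 4 : ℝ) ∈ (mappingTorusPieceOne : Set ℝ)
  rw [coe_mappingTorusPieceOne]
  constructor <;> norm_num

/-- `5/4 ∈ (1/2, 3/2)`: the same page angle, one turn later, in the second cylinder. [folklore] -/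
private theorem fiveQuarter_mem_mappingTorusPieceTwo : (5 / 4 : ℝ) ∈ mappingTorusPieceTwo := by
  change (5 / 4 : ℝ) ∈ (mappingTorusPieceTwo : Set ℝ)
  rw [coe_mappingTorusPieceTwo]
  constructor <;> norm_num

/-- **The monodromy is the identity on the punctured disc** (data form). If `jA`, `jB` glue
`(F ∖ {p}) × (0,1)` and `(F ∖ {p}) × (1/2,3/2)` along `mappingTorusRel θ` and both are the
standard open book of `ν` on the punctured disc chart `d`, then `θ` fixes every page point
`y = d (r • u)`, `0 < r < 1`: indeed `jA (y, ¼) = ν (u, r • e^{iπ/2}) = jB (y, 5/4)` by the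
standard clauses and periodicity of `circlePoint`, while `jA (y, ¼) = jB (θ y, 5/4)` by the
gluing relation, and `jB` is injective. This is the clause "the monodromy is the identity near
`∂Σ`" of an abstract open book (Etnyre 2006, Def. 2.2), derived. [cite: Etnyre2006, §2 Def. 2.2] -/
theorem Knot.FibresWithVia.theta_apply_eq {θ : ↥(punctureAt p) → ↥(punctureAt p)}
    {jA : ↥(punctureAt p) × ↥mappingTorusPieceOne → ↥K.complement}
    {jB : ↥(punctureAt p) × ↥mappingTorusPieceTwo → ↥K.complement} {d : (𝔼 2) → F}
    (hglue : IsOpenGluingWith ((𝓡 2).prod 𝓘(ℝ, ℝ)) ((𝓡 2).prod 𝓘(ℝ, ℝ)) (𝓡 3)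
      (mappingTorusRel θ) jA jB)
    (hstd : ∀ (y : ↥(punctureAt p)) (u : 𝕊 1) (r : ℝ), r ∈ Ioo (0 : ℝ) 1 →
      (y : F) = d (r • ((u : 𝕊 1) : 𝔼 2)) →
        (∀ s : ↥mappingTorusPieceOne,
          ((jA (y, s) : ↥K.complement) : 𝕊 3) =
            ν (u, r • ((circlePoint (2 * Real.pi * (s : ℝ)) : 𝕊 1) : 𝔼 2))) ∧
        (∀ t : ↥mappingTorusPieceTwo,
          ((jB (y, t) : ↥K.complement) : 𝕊 3) =
            ν (u, r • ((circlePoint (2 * Real.pi * (t : ℝ)) : 𝕊 1) : 𝔼 2))))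
    {y : ↥(punctureAt p)} {u : 𝕊 1} {r : ℝ} (hr : r ∈ Ioo (0 : ℝ) 1)
    (hy : (y : F) = d (r • ((u : 𝕊 1) : 𝔼 2))) : θ y = y := by
  obtain ⟨-, -, hB, -, -, hR⟩ := hglue
  set s₀ : ↥mappingTorusPieceOne := ⟨1 / 4, quarter_mem_mappingTorusPieceOne⟩ with hs₀
  set t₀ : ↥mappingTorusPieceTwo := ⟨5 / 4, fiveQuarter_mem_mappingTorusPieceTwo⟩ with ht₀
  -- the gluing relation: `jA (y, 1/4) = jB (θ y, 5/4)`
  have hglued : jA (y, s₀) = jB (θ y, t₀) :=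
    (hR (y, s₀) (θ y, t₀)).mpr (Or.inr ⟨by simp only [hs₀, ht₀]; norm_num, rfl⟩)
  -- the standard clauses: `jA (y, 1/4) = jB (y, 5/4)` (same page point, one turn later)
  have hper : circlePoint (2 * Real.pi * ((t₀ : ℝ))) = circlePoint (2 * Real.pi * ((s₀ : ℝ))) := by
    have : 2 * Real.pi * ((t₀ : ℝ)) = 2 * Real.pi * ((s₀ : ℝ)) + 2 * Real.pi := by
      simp only [hs₀, ht₀]; ring
    rw [this, circlePoint_add_two_pi]
  have hsame : jA (y, s₀) = jB (y, t₀) := by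
    apply Subtype.ext
    rw [(hstd y u r hr hy).1 s₀, (hstd y u r hr hy).2 t₀, hper]
  have hinj := hB.isEmbedding.injective (hglued.symm.trans hsame)
  exact congrArg Prod.fst hinj

/-- **The capped monodromy is the identity on the capping disc.** If `K` fibres through `ν` with
capped fibre `F`, puncture `p` and capped monodromy `φ`, there is a disc chart `d : ℝ² → F` at
`p` (`C^∞` embedding, open range, `d 0 = p`) with `φ (d w) = d w` for all `‖w‖ < 1`: `φ` is the
closed monodromy `ĥ = h ∪ id` obtained by capping the page monodromy `h` (the identity near the
boundary of the page) with the identity of a disc (Etnyre 2006, Def. 2.2; Abe–Tagami 2016, §5.5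
"closed monodromy"). [cite: AbeTagami2016, App. B §5.1 and §5.5] -/
theorem Knot.FibresWithVia.exists_disc_fixed (h : K.FibresWithVia ν F p φ) :
    ∃ d : (𝔼 2) → F, Manifold.IsSmoothEmbedding (𝓡 2) (𝓡 2) ∞ d ∧ IsOpen (range d) ∧ d 0 = p ∧
      ∀ w : 𝔼 2, ‖w‖ < 1 → φ (d w) = d w := by
  have hp : φ p = p := h.apply_puncture
  obtain ⟨θ, jA, jB, d, hθ, hglue, hd, hdo, hd0, hstd⟩ := h
  refine ⟨d, hd, hdo, hd0, fun w hw => ?_⟩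
  by_cases hw0 : w = 0
  · rw [hw0, hd0, hp]
  · have hnorm : 0 < ‖w‖ := norm_pos_iff.mpr hw0
    -- polar form `w = ‖w‖ • u`, `u ∈ 𝕊 1`
    let u : 𝕊 1 := ⟨‖w‖⁻¹ • w, by
      rw [mem_sphere_zero_iff_norm, norm_smul, norm_inv, norm_norm, inv_mul_cancel₀ hnorm.ne']⟩
    have hwu : ‖w‖ • ((u : 𝕊 1) : 𝔼 2) = w := by
      change ‖w‖ • (‖w‖⁻¹ • w) = w
      rw [smul_smul, mul_inv_cancel₀ hnorm.ne', one_smul]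
    have hdw : d w ≠ p := by -- `d` is injective, `d 0 = p`, `w ≠ 0`
      rw [← hd0]
      exact fun h' => hw0 (hd.isEmbedding.injective h')
    let y : ↥(punctureAt p) := ⟨d w, mem_punctureAt_iff.mpr hdw⟩
    have hy : (y : F) = d (‖w‖ • ((u : 𝕊 1) : 𝔼 2)) := by rw [hwu]
    have hθy : θ y = y :=
      Knot.FibresWithVia.theta_apply_eq (ν := ν) hglue hstd ⟨hnorm, hw⟩ hy
    calc φ (d w) = ((θ y : ↥(punctureAt p)) : F) := (hθ y).symm
      _ = (y : F) := by rw [hθy]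
      _ = d w := rfl

end FibredKnot

end Literature.Topology.FourManifolds
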